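import Summits.QuantumFields.GaugeBoot.DiagonalRPTorusRestShape
import Summits.QuantumFields.GaugeBoot.DiagonalRPTorusPolyakovTrick
import Summits.QuantumFields.GaugeBoot.DiagonalRPTorusBandTerm
import HarnessLib

/-!
# Pair terms of rest clusters: vanishing below order `2L` and the two cross bands (gauge-boot,
task L3 sequel `d = 3`, `L = 4`; 4/5)

HONEST FRAMING (cell `pub-gaugeboot`, page 1 of every file): the venture produces certified bounds
on lattice expectations at stated coupling, gauge group, dimension and torus size; NOT a mass gap,
NOT a continuum limit, NOT a string tension; NOT Yang–Mills-summit-bearing (barriers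
`FixedCouplingUltralocality`, `PerturbativeInvisibility`). This module is bookkeeping for a
structural NEGATIVE result (`DiagonalRPTorusInnerHalfNegativeThreeAll`); it discharges nothing by
itself.

## Content (three-torus `(ℤ/L)³`, `L = 2c`, `c ≥ 2`, mirror `x₀ = x₁`; compact metrisable `G`,
continuous `ρ` with a centre element `ρ z₀ = ω • 1`, `ω ≠ 1`)

For a column `A` on the top inner layer (`δ(A) = c - 1`) and a column `A'` on its mirror image
(`δ(A') = -(c-1)`), the pair terms `T_S(A', A)` of the REST clusters `S ⊆ restPlaqs 0 1 c` with
`|S| ≤ 2L` (the shape theorem `DiagRPRest.rest_shape` + centre twist + lonely-link reduction):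
* `pairTerm_rest_cases` — `T_S(A',A) = 0` unless `A' = A + 2e₀ ∧ S = band A (0,2)`, or
  `A = A' + 2e₁ ∧ S = band A' (1,2)`, or `A' + e₁ = A + e₀`;
* `pairTerm_rest_eq_zero_of_offsets` (none of the three offsets), `…_of_ne_band02`,
  `…_of_ne_band12` (the offset `2e₀` / `-2e₁` with `S` not the band);
* the bands lie in the rest (`band02_subset_restPlaqs`, `band12_subset_restPlaqs`);
* sums over all rest clusters (`0 ≤ β`, `γ = 2βN ≤ 1`): **`abs_sum_rest_le_of_offsets`**
  `|Σ_S T_S(A',A)| ≤ 2^{#rest} N² γ^{2L+1}`; **`sum_rest_ge_band02`** / **`sum_rest_ge_band12`**: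
  for `A' = A + 2e₀` (resp. `A = A' + 2e₁`),
  `Σ_S T_S(A',A) ≥ β^{2L} J - N² 2^{2L} (βN)^{2L+1} - 2^{#rest} N² γ^{2L+1}` with the BAND INTEGRAL
  `J = bandIntegral ρ (0,2) A` (resp. `bandIntegral ρ (1,2) A'`) of `DiagonalRPTorusBandTerm`
  (positive for `SU(N)`, `U(N)`: `DiagRPSUN.bandIntegral_pos`).

Elementary bookkeeping; no named fact.
-/

open MeasureTheory Finset Function
open scoped ComplexOrder

namespace Summit.QuantumFields.GaugeBoot

open Literature.MathematicalPhysics.QuantumFieldTheory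

noncomputable section

namespace DiagRPRest

open DiagRPThree DiagRPPolyakov DiagRPSUN
open DiagRPTube (restPlaqs cast_pred_add_one neg_cast_c)

/-! ## The bands lie in the rest -/

section Bands

variable {L : ℕ} [NeZero L] {c : ℕ}

/-- The band of the plane `(0,2)` over a top-inner-layer column lies in the rest. -/
theorem band02_subset_restPlaqs (hc : 2 ≤ c) (hL : L = 2 * c) {A : ZMod L × ZMod L}
    (hA : A.1 - A.2 = ((c - 1 : ℕ) : ZMod L)) : band A plane02 ⊆ restPlaqs (0 : Fin 3) 1 c := by
  intro p hp
  unfold band at hp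
  rcases mem_union.1 hp with hp | hp
  · obtain ⟨z, rfl⟩ := mem_ladder.1 hp
    exact low02_mem_restPlaqs hc hL hA z
  · obtain ⟨z, rfl⟩ := mem_ladder.1 hp
    refine mem_restPlaqs_of_lay_vert hc hL 0 ?_
    show DiagRPTube.lay 0 1 (vsite (bump 0 A) z) = _
    rw [lay_vsite, lay_bump_zero, hA, cast_pred_add_one hc]

/-- The band of the plane `(1,2)` over a column of the layer `-(c-1)` lies in the rest. -/
theorem band12_subset_restPlaqs (hc : 2 ≤ c) (hL : L = 2 * c) {A' : ZMod L × ZMod L}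
    (hA' : A'.1 - A'.2 = -((c - 1 : ℕ) : ZMod L)) : band A' plane12 ⊆ restPlaqs (0 : Fin 3) 1 c := by
  intro p hp
  unfold band at hp
  rcases mem_union.1 hp with hp | hp
  · obtain ⟨z, rfl⟩ := mem_ladder.1 hp
    exact high12_mem_restPlaqs hc hL hA' z
  · obtain ⟨z, rfl⟩ := mem_ladder.1 hp
    refine mem_restPlaqs_of_lay_vert hc hL 0 ?_
    show DiagRPTube.lay 0 1 (vsite (bump 1 A') z) = _
    rw [lay_vsite, lay_bump_one, hA', ← neg_add', cast_pred_add_one hc, neg_cast_c hL]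

omit [NeZero L] in
/-- The three offsets are mutually exclusive, I: `A' = A + 2e₀` excludes the other two
(`L = 2c ≥ 4`). -/
theorem offsets_of_band02 (hc : 2 ≤ c) (hL : L = 2 * c) {A A' : ZMod L × ZMod L}
    (h : A' = bump 0 (bump 0 A)) : A ≠ bump 1 (bump 1 A') ∧ bump 1 A' ≠ bump 0 A := by
  obtain ⟨h1, h2, -⟩ := one_two_three_ne_zero hc hL
  subst h
  refine ⟨fun hh => h2 ?_, fun hh => h1 ?_⟩
  · have e := congrArg Prod.fst hh
    simp only [bump_zero, bump_one] at e
    linear_combination -e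
  · have e := congrArg Prod.fst hh
    simp only [bump_zero, bump_one] at e
    linear_combination e

omit [NeZero L] in
/-- The three offsets are mutually exclusive, II: `A = A' + 2e₁` excludes the other two. -/
theorem offsets_of_band12 (hc : 2 ≤ c) (hL : L = 2 * c) {A A' : ZMod L × ZMod L}
    (h : A = bump 1 (bump 1 A')) : A' ≠ bump 0 (bump 0 A) ∧ bump 1 A' ≠ bump 0 A := by
  obtain ⟨h1, h2, -⟩ := one_two_three_ne_zero hc hL
  subst h
  refine ⟨fun hh => h2 ?_, fun hh => h1 ?_⟩
  · have e := congrArg Prod.snd hh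
    simp only [bump_zero, bump_one] at e
    linear_combination -e
  · have e := congrArg Prod.fst hh
    simp only [bump_zero, bump_one] at e
    linear_combination -e

end Bands

/-! ## Pair terms of rest clusters -/

section Pair

variable {L : ℕ} [NeZero L] {N : ℕ} {G : Type*} [Group G] [TopologicalSpace G]
  [IsTopologicalGroup G] [CompactSpace G] [MeasurableSpace G] [BorelSpace G]
  [SecondCountableTopology G] (ρ : G →* Matrix (Fin N) (Fin N) ℂ) (β : ℝ) {c : ℕ}

/-- ★ **Pair terms of rest clusters below order `2L`.** `L = 2c`, `c ≥ 2`, `δ(A) = c - 1`,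
`δ(A') = -(c-1)`, `S ⊆ rest`, `|S| ≤ 2L`: `T_S(A',A) = 0`, or `A' = A + 2e₀` and `S` is the
band `(0,2)` over `A`, or `A = A' + 2e₁` and `S` is the band `(1,2)` over `A'`, or
`A' + e₁ = A + e₀`. -/
theorem pairTerm_rest_cases (hρ : Continuous ρ) {z₀ : G} {ω : ℂ}
    (hz₀ : ρ z₀ = ω • (1 : Matrix (Fin N) (Fin N) ℂ)) (hω : ω ≠ 1) (hc : 2 ≤ c) (hL : L = 2 * c)
    {A A' : ZMod L × ZMod L} (hA : A.1 - A.2 = ((c - 1 : ℕ) : ZMod L))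
    (hA' : A'.1 - A'.2 = -((c - 1 : ℕ) : ZMod L)) {S : Finset (Plaquette 3 L)}
    (hS : S ⊆ restPlaqs (0 : Fin 3) 1 c) (hcard : S.card ≤ 2 * L) :
    pairTerm ρ β S A' A = 0 ∨ (A' = bump 0 (bump 0 A) ∧ S = band A plane02) ∨
      (A = bump 1 (bump 1 A') ∧ S = band A' plane12) ∨ bump 1 A' = bump 0 A := by
  have hL1 : 1 < L := by omega
  obtain ⟨hne, hnadj⟩ := ne_and_not_adj hc hL hA hA'
  by_cases hcA' : Covers S A'
  · by_cases hcA : Covers S A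
    · rcases rest_shape hc hL hA hA' hS hcA' hcA hcard with ⟨p, hp, ℓ, hℓ, hA'ℓ, hAℓ, hlone⟩ | h
      · left
        refine pairTerm_eq_zero_of_lonely ρ β hρ hL1 hp hℓ hlone hA'ℓ hAℓ ?_
        exact pairTerm_eq_zero_of_card_lt ρ β hρ hz₀ hω hne.symm (fun h => hnadj h.symm)
          (by rw [card_erase_of_mem hp]; have := card_pos.2 ⟨p, hp⟩; omega)
      · exact Or.inr h
    · exact Or.inl (pairTerm_eq_zero_of_not_covers_right ρ β hρ hz₀ hω hne.symm hcA)
  · exact Or.inl (pairTerm_eq_zero_of_not_covers_left ρ β hρ hz₀ hω hne.symm hcA')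

/-- **No offset**: every rest pair term of order `≤ 2L` vanishes when `A' - A ∉ {2e₀, e₀ - e₁,
-2e₁}`. -/
theorem pairTerm_rest_eq_zero_of_offsets (hρ : Continuous ρ) {z₀ : G} {ω : ℂ}
    (hz₀ : ρ z₀ = ω • (1 : Matrix (Fin N) (Fin N) ℂ)) (hω : ω ≠ 1) (hc : 2 ≤ c) (hL : L = 2 * c)
    {A A' : ZMod L × ZMod L} (hA : A.1 - A.2 = ((c - 1 : ℕ) : ZMod L))
    (hA' : A'.1 - A'.2 = -((c - 1 : ℕ) : ZMod L)) (h1 : A' ≠ bump 0 (bump 0 A))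
    (h2 : A ≠ bump 1 (bump 1 A')) (h3 : bump 1 A' ≠ bump 0 A) {S : Finset (Plaquette 3 L)}
    (hS : S ⊆ restPlaqs (0 : Fin 3) 1 c) (hcard : S.card ≤ 2 * L) : pairTerm ρ β S A' A = 0 := by
  rcases pairTerm_rest_cases ρ β hρ hz₀ hω hc hL hA hA' hS hcard with h | ⟨h, -⟩ | ⟨h, -⟩ | h
  · exact h
  · exact absurd h h1
  · exact absurd h h2
  · exact absurd h h3

/-- **Offset `2e₀`, not the band**: `T_S(A + 2e₀, A) = 0` for every rest cluster `S ≠ band A (0,2)`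
of order `≤ 2L`. -/
theorem pairTerm_rest_eq_zero_of_ne_band02 (hρ : Continuous ρ) {z₀ : G} {ω : ℂ}
    (hz₀ : ρ z₀ = ω • (1 : Matrix (Fin N) (Fin N) ℂ)) (hω : ω ≠ 1) (hc : 2 ≤ c) (hL : L = 2 * c)
    {A A' : ZMod L × ZMod L} (hA : A.1 - A.2 = ((c - 1 : ℕ) : ZMod L))
    (hA' : A'.1 - A'.2 = -((c - 1 : ℕ) : ZMod L)) (hrel : A' = bump 0 (bump 0 A))
    {S : Finset (Plaquette 3 L)} (hS : S ⊆ restPlaqs (0 : Fin 3) 1 c) (hcard : S.card ≤ 2 * L)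
    (hSb : S ≠ band A plane02) : pairTerm ρ β S A' A = 0 := by
  obtain ⟨h2, h3⟩ := offsets_of_band02 hc hL hrel
  rcases pairTerm_rest_cases ρ β hρ hz₀ hω hc hL hA hA' hS hcard with h | ⟨-, h⟩ | ⟨h, -⟩ | h
  · exact h
  · exact absurd h hSb
  · exact absurd h h2
  · exact absurd h h3

/-- **Offset `-2e₁`, not the band**: `T_S(A', A' + 2e₁) = 0` for every rest cluster
`S ≠ band A' (1,2)` of order `≤ 2L`. -/
theorem pairTerm_rest_eq_zero_of_ne_band12 (hρ : Continuous ρ) {z₀ : G} {ω : ℂ}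
    (hz₀ : ρ z₀ = ω • (1 : Matrix (Fin N) (Fin N) ℂ)) (hω : ω ≠ 1) (hc : 2 ≤ c) (hL : L = 2 * c)
    {A A' : ZMod L × ZMod L} (hA : A.1 - A.2 = ((c - 1 : ℕ) : ZMod L))
    (hA' : A'.1 - A'.2 = -((c - 1 : ℕ) : ZMod L)) (hrel : A = bump 1 (bump 1 A'))
    {S : Finset (Plaquette 3 L)} (hS : S ⊆ restPlaqs (0 : Fin 3) 1 c) (hcard : S.card ≤ 2 * L)
    (hSb : S ≠ band A' plane12) : pairTerm ρ β S A' A = 0 := by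
  obtain ⟨h1, h3⟩ := offsets_of_band12 hc hL hrel
  rcases pairTerm_rest_cases ρ β hρ hz₀ hω hc hL hA hA' hS hcard with h | ⟨h, -⟩ | ⟨-, h⟩ | h
  · exact h
  · exact absurd h h1
  · exact absurd h hSb
  · exact absurd h h3

/-! ## Sums over all rest clusters -/

/-- ★ **Diagonal-type pairs**: `|Σ_{S ⊆ rest} T_S(A',A)| ≤ 2^{#rest} N² γ^{2L+1}` when
`A' - A ∉ {2e₀, e₀ - e₁, -2e₁}` (`0 ≤ β`, `γ = 2βN ≤ 1`). -/
theorem abs_sum_rest_le_of_offsets (hρ : Continuous ρ) {z₀ : G} {ω : ℂ}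
    (hz₀ : ρ z₀ = ω • (1 : Matrix (Fin N) (Fin N) ℂ)) (hω : ω ≠ 1) (hβ : 0 ≤ β)
    (hγ : 2 * β * N ≤ 1) (hc : 2 ≤ c) (hL : L = 2 * c) {A A' : ZMod L × ZMod L}
    (hA : A.1 - A.2 = ((c - 1 : ℕ) : ZMod L)) (hA' : A'.1 - A'.2 = -((c - 1 : ℕ) : ZMod L))
    (h1 : A' ≠ bump 0 (bump 0 A)) (h2 : A ≠ bump 1 (bump 1 A')) (h3 : bump 1 A' ≠ bump 0 A) :
    |∑ S ∈ (restPlaqs (L := L) (0 : Fin 3) 1 c).powerset, pairTerm ρ β S A' A| ≤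
      2 ^ (restPlaqs (L := L) (0 : Fin 3) 1 c).card * (N ^ 2 * (2 * β * N) ^ (2 * L + 1)) :=
  abs_sum_pairTerm_le_of_vanish ρ β hρ hβ hγ _ A' A fun _ hS hcard =>
    pairTerm_rest_eq_zero_of_offsets ρ β hρ hz₀ hω hc hL hA hA' h1 h2 h3 (mem_powerset.1 hS) hcard

/-- ★ **The cross pair `(A + 2e₀, A)`**: `Σ_{S ⊆ rest} T_S(A + 2e₀, A) ≥ β^{2L} J - N² 2^{2L}
(βN)^{2L+1} - 2^{#rest} N² γ^{2L+1}`, `J = bandIntegral ρ (0,2) A`. -/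
theorem sum_rest_ge_band02 (hρ : Continuous ρ) {z₀ : G} {ω : ℂ}
    (hz₀ : ρ z₀ = ω • (1 : Matrix (Fin N) (Fin N) ℂ)) (hω : ω ≠ 1) (hβ : 0 ≤ β)
    (hγ : 2 * β * N ≤ 1) (hc : 2 ≤ c) (hL : L = 2 * c) {A A' : ZMod L × ZMod L}
    (hA : A.1 - A.2 = ((c - 1 : ℕ) : ZMod L)) (hA' : A'.1 - A'.2 = -((c - 1 : ℕ) : ZMod L))
    (hrel : A' = bump 0 (bump 0 A)) :
    β ^ (2 * L) * bandIntegral ρ plane02 A - N ^ 2 * (2 ^ (2 * L) * (β * N) ^ (2 * L + 1)) -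
        2 ^ (restPlaqs (L := L) (0 : Fin 3) 1 c).card * (N ^ 2 * (2 * β * N) ^ (2 * L + 1)) ≤
      ∑ S ∈ (restPlaqs (L := L) (0 : Fin 3) 1 c).powerset, pairTerm ρ β S A' A := by
  have hL1 : 1 < L := by omega
  have hβN : β * N ≤ 1 := by nlinarith [mul_nonneg hβ (Nat.cast_nonneg N : (0 : ℝ) ≤ N)]
  have htail := abs_sum_pairTerm_sub_le_of_vanish ρ β hρ hβ hγ (restPlaqs (L := L) (0 : Fin 3) 1 c)
    A' A (mem_powerset.2 (band02_subset_restPlaqs hc hL hA)) (by rw [card_band hL1 A plane02 rfl])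
    fun _ hS hcard hSb =>
      pairTerm_rest_eq_zero_of_ne_band02 ρ β hρ hz₀ hω hc hL hA hA' hrel (mem_powerset.1 hS) hcard hSb
  have hband : |pairTerm ρ β (band A plane02) (bump 0 (bump 0 A)) A -
      β ^ (2 * L) * bandIntegral ρ plane02 A| ≤ N ^ 2 * (2 ^ (2 * L) * (β * N) ^ (2 * L + 1)) :=
    abs_pairTerm_band_sub_le ρ β hρ hβ hβN hL1 plane02 rfl A
  subst hrel
  rw [abs_le] at htail hband
  linarith [htail.1, hband.1]

/-- ★ **The cross pair `(A', A' + 2e₁)`**: `Σ_{S ⊆ rest} T_S(A', A' + 2e₁) ≥ β^{2L} J -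
N² 2^{2L} (βN)^{2L+1} - 2^{#rest} N² γ^{2L+1}`, `J = bandIntegral ρ (1,2) A'`. -/
theorem sum_rest_ge_band12 (hρ : Continuous ρ) {z₀ : G} {ω : ℂ}
    (hz₀ : ρ z₀ = ω • (1 : Matrix (Fin N) (Fin N) ℂ)) (hω : ω ≠ 1) (hβ : 0 ≤ β)
    (hγ : 2 * β * N ≤ 1) (hc : 2 ≤ c) (hL : L = 2 * c) {A A' : ZMod L × ZMod L}
    (hA : A.1 - A.2 = ((c - 1 : ℕ) : ZMod L)) (hA' : A'.1 - A'.2 = -((c - 1 : ℕ) : ZMod L))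
    (hrel : A = bump 1 (bump 1 A')) :
    β ^ (2 * L) * bandIntegral ρ plane12 A' - N ^ 2 * (2 ^ (2 * L) * (β * N) ^ (2 * L + 1)) -
        2 ^ (restPlaqs (L := L) (0 : Fin 3) 1 c).card * (N ^ 2 * (2 * β * N) ^ (2 * L + 1)) ≤
      ∑ S ∈ (restPlaqs (L := L) (0 : Fin 3) 1 c).powerset, pairTerm ρ β S A' A := by
  have hL1 : 1 < L := by omega
  have hβN : β * N ≤ 1 := by nlinarith [mul_nonneg hβ (Nat.cast_nonneg N : (0 : ℝ) ≤ N)]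
  have htail := abs_sum_pairTerm_sub_le_of_vanish ρ β hρ hβ hγ (restPlaqs (L := L) (0 : Fin 3) 1 c)
    A' A (mem_powerset.2 (band12_subset_restPlaqs hc hL hA')) (by rw [card_band hL1 A' plane12 rfl])
    fun _ hS hcard hSb =>
      pairTerm_rest_eq_zero_of_ne_band12 ρ β hρ hz₀ hω hc hL hA hA' hrel (mem_powerset.1 hS) hcard hSb
  have hband : |pairTerm ρ β (band A' plane12) (bump 1 (bump 1 A')) A' -
      β ^ (2 * L) * bandIntegral ρ plane12 A'| ≤ N ^ 2 * (2 ^ (2 * L) * (β * N) ^ (2 * L + 1)) :=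
    abs_pairTerm_band_sub_le ρ β hρ hβ hβN hL1 plane12 rfl A'
  rw [pairTerm_comm] at hband
  subst hrel
  rw [abs_le] at htail hband
  linarith [htail.1, hband.1]

end Pair

end DiagRPRest

end

end Summit.QuantumFields.GaugeBoot
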